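import Literature.Analysis.FluidPDE.NSCriticalClosureProofs
import Literature.Analysis.FluidPDE.LerayHopfProofs
import Literature.Analysis.FluidPDE.TaoH1LocalExistence
import Literature.Analysis.FluidPDE.EnstrophyGronwall
import Literature.Analysis.FluidPDE.NSVorticityDifference
import Literature.Analysis.FluidPDE.NSSerrinUniqueness
import HarnessLib

/-!
# The `L³` continuation criterion — assembly 3: ESS (3.6) + Tao's smooth `H¹` local theory

Third assembly of the named fact `Literature.Analysis.FluidPDE.hasSmoothExtensionPast_of_eLpNorm_three_bounded`
(`NSCriticalClosure.lean`; assemblies 1–2 in `NSCriticalClosureProofs.lean`). It replaces the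
Leray-1934 input `NS.leray_blowup_rate_top` of assembly 2 by

* `NS.tao2011_smooth_local_existence` (Tao 2013, Thm. 5.4 (ii)+(iv): smooth solutions from smooth
  `H^∞` data live at least for time `c ν³ ‖u₀‖_{H¹}^{-4}`, with `u, ∂ₜu, p ∈ L^∞_t H^k_x`),
* weak–strong uniqueness (Prodi–Serrin) to identify these local solutions with the given
  Leray–Hopf solution — the **proved** `NS.serrin_weak_strong_uniqueness_holds`
  (`NSSerrinUniqueness.lean`, datum in `L²`; the restart data `u(t')` are in `L²`), or the named
  fact `NS.weak_strong_uniqueness` in the earlier form `…_of_tao` — and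
* the **proved** enstrophy inequality under an `L^∞` bound
  (`NS.lintegral_frobeniusNormSq_fderiv_le_mul_exp`, `EnstrophyGronwall.lean`;
  Lemarié-Rieusset 2016, Thm. 11.2),

keeping `NS.ess_sup_bound` (Escauriaza–Seregin–Šverák 2003, §3 (3.5)–(3.6)). The net result
(`hasSmoothExtensionPast_of_eLpNorm_three_bounded_of_ess_tao`): the fact follows from the two
named facts `NS.ess_sup_bound` and `NS.tao2011_smooth_local_existence`, everything else proved.

## The argument (`hasSmoothExtensionPast_of_eLpNorm_three_bounded_of_tao'`, `…_of_ess_tao`)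

Let `(u, p)` be classical on `[0, T)`, Leray–Hopf from the Schwartz datum `u(0)`, with
`sup_{[0,T)} ‖u(t)‖₃ < ∞`, and suppose `u` does not extend past `T`.

1. *A first smooth patch.* `u(0)` is smooth, divergence free and in `H^∞`, so Tao's theorem gives
   a smooth solution `v₀` on `[0, T₁]`, `0 < T₁ < T`, with all Sobolev bounds; `v₀` is bounded
   (Sobolev imbedding `linfty_bound_of_hasBoundedSobolevNormsOn_holds`) and Leray–Hopf
   (`IsClassicalNSSolutionOn.isLerayHopfOn_holds`), so by weak–strong uniqueness `u = v₀` on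
   `[0, T₁]`: the slices `u(t)`, `t ≤ T₁`, are in `H^∞` with `∫ |∇u(t)|²` finite.
2. *The `L^∞` bound.* By ESS (3.6), `|u| ≤ M` on `(T₁/4, T) × ℝ³` (pointwise, by continuity).
3. *Uniform restart data.* Fix an energy-good restarting time `t⋆ ∈ (T₁/2, T₁)`
   (`IsLerayHopfOn.ae_isLerayHopfOn_translate`), let `g₀ = ∫ |∇u(t⋆)|²`, `E₀` the initial energy,
   `A = 2E₀ + g₀ e^{M²T/(2ν)}` and `τ = c ν³ / (A² + 1)`. *Invariant* `I(F)`: for all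
   `t ∈ [t⋆, F]`, `u(t) ∈ H^∞` and `∫ |∇u(t)|² ≤ g₀ e^{M²(t - t⋆)/(2ν)}`.
4. *Marching step.* If `I(F)` with `F < T`, pick a good time `t' ∈ (F - τ/4, F] ∩ [t⋆, F]`; then
   `‖u(t')‖²_{H¹} ≤ A`, so Tao's theorem from the datum `u(t')` gives a smooth `v` on `[0, τ]`;
   `u(· + t') = v` on `[0, min(τ, T - t'))` (weak–strong uniqueness as in 1). If `t' + τ > T`
   this is a smooth extension of `u` past `T` (`HasSmoothExtensionPast.of_translate`) —
   excluded; so `t' + τ ≤ T`, and the enstrophy inequality for `v` (bounded by `M`, being equal to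
   `u` there) propagates the invariant to `I(t' + τ/2)`, with `t' + τ/2 > F + τ/4`.
5. Hence `I(F_k)` with `F_k ≥ t⋆ + kτ/4` and `F_k < T` for all `k` — absurd.

## References

* L. Escauriaza, G. Seregin, V. Šverák, Russ. Math. Surveys 58 (2003), Thm. 1.3, §3 (3.5)–(3.6).
* T. Tao, Anal. PDE 6 (2013) = arXiv:1108.1165, Thm. 5.4 (arXiv Thm. 31), Cor. 5.? "Maximal
  Cauchy development" (arXiv Cor. 35, p. 20) — the dichotomy which steps 3–5 reproduce under
  the `L^∞` bound.
* P. G. Lemarié-Rieusset, *The Navier–Stokes Problem in the 21st Century* (2016), Thm. 11.2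
  (Serrin's criterion in the `H¹` class) and Thm. 7.2 (`H¹` blow-up alternative).
* G. Prodi (1959), J. Serrin (1963): weak–strong uniqueness.
-/

noncomputable section

open MeasureTheory Set Function Filter Topology
open scoped ENNReal NNReal

namespace Literature.Analysis.FluidPDE

/-! ### Small measure-theoretic helpers -/

/-- A field with continuous slices, bounded pointwise by `C` on `S × ℝ³`, lies in
`L^∞(S; L^∞)`. [folklore] -/
theorem memLqLp_top_top_of_forall_norm_le {S : Set ℝ} (hS : MeasurableSet S)
    {u : ℝ → EuclideanSpace ℝ (Fin 3) → EuclideanSpace ℝ (Fin 3)} {C : ℝ} (hC0 : 0 ≤ C)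
    (hcont : ∀ t ∈ S, Continuous (u t)) (hC : ∀ t ∈ S, ∀ x, ‖u t x‖ ≤ C) :
    FluidPDE.MemLqLp ∞ ∞ u S := by
  have hslice : ∀ t ∈ S, MemLp (u t) ∞ volume ∧ (eLpNorm (u t) ∞ volume).toReal ≤ C := by
    intro t ht
    have hm : MemLp (u t) ∞ volume :=
      memLp_top_of_bound (hcont t ht).aestronglyMeasurable C (Eventually.of_forall (hC t ht))
    refine ⟨hm, ?_⟩
    have h1 : eLpNorm (u t) ∞ volume ≤ ENNReal.ofReal C := by
      rw [eLpNorm_exponent_top]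
      exact eLpNormEssSup_le_of_ae_bound (Eventually.of_forall (hC t ht))
    exact (ENNReal.toReal_le_toReal hm.eLpNorm_ne_top ENNReal.ofReal_ne_top).2 h1 |>.trans
      (by rw [ENNReal.toReal_ofReal hC0])
  refine ⟨(ae_restrict_iff' hS).2 (Eventually.of_forall fun t ht => (hslice t ht).1), ?_⟩
  rw [FluidPDE.eLqLpNorm, eLpNorm_exponent_top]
  refine eLpNormEssSup_lt_top_of_ae_bound (C := C) ((ae_restrict_iff' hS).2
    (Eventually.of_forall fun t ht => ?_))
  rw [Real.norm_of_nonneg ENNReal.toReal_nonneg]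
  exact (hslice t ht).2

/-- An a.e. property on an interval of positive length holds somewhere in it. [folklore] -/
theorem exists_mem_Ioo_of_ae_restrict {a b : ℝ} (hab : a < b) {P : ℝ → Prop}
    (h : ∀ᵐ s ∂((volume : Measure ℝ).restrict (Ioo a b)), P s) : ∃ s ∈ Ioo a b, P s := by
  by_contra hne
  push Not at hne
  have hfalse : ∀ᵐ s ∂((volume : Measure ℝ).restrict (Ioo a b)), False := by
    filter_upwards [h, ae_restrict_mem measurableSet_Ioo] with s hs hs'
    exact hne s hs' hs
  rw [eventually_false_iff_eq_bot, ae_eq_bot, Measure.restrict_eq_zero, Real.volume_Ioo] at hfalse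
  exact absurd hfalse (ENNReal.ofReal_pos.2 (by linarith)).ne'

/-- Continuous slices which agree a.e. agree everywhere. [folklore] -/
theorem eq_of_ae_eq_of_continuous {f g : EuclideanSpace ℝ (Fin 3) → EuclideanSpace ℝ (Fin 3)}
    (hf : Continuous f) (hg : Continuous g) (h : f =ᵐ[volume] g) : f = g :=
  (Continuous.ae_eq_iff_eq volume hf hg).1 h

/-! ### Tao's smooth `H¹` solutions are bounded Leray–Hopf solutions -/

/-- A classical solution on `[0, T] × ℝ³` with all Sobolev norms of `u` bounded is bounded by a
nonnegative constant (Sobolev imbedding `H² ⊂ C_B`,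
`linfty_bound_of_hasBoundedSobolevNormsOn_holds`). [cite: AdamsFournier2003, Thm. 4.12 Part I Case A] -/
theorem exists_forall_norm_le_of_hasBoundedSobolevNormsOn {ν T : ℝ}
    {u : ℝ → EuclideanSpace ℝ (Fin 3) → EuclideanSpace ℝ (Fin 3)}
    {p : ℝ → EuclideanSpace ℝ (Fin 3) → ℝ} (hsol : FluidPDE.IsClassicalNSSolutionOn (Icc 0 T) ν 0 u p)
    (hu : HasBoundedSobolevNormsOn (Icc 0 T) u) :
    ∃ B : ℝ, 0 ≤ B ∧ ∀ t ∈ Icc 0 T, ∀ x, ‖u t x‖ ≤ B := by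
  obtain ⟨C, hC⟩ := linfty_bound_of_hasBoundedSobolevNormsOn_holds
    (fun t ht => (hsol.contDiff_velocity ht).of_le (by norm_cast)) hu
  exact ⟨max C 0, le_max_right _ _, fun t ht x => (hC t ht x).trans (le_max_left _ _)⟩

/-- **Tao's smooth `H¹` solutions are Leray–Hopf.** A classical solution of the unforced system on
the closed slab `[0, T] × ℝ³` with `u ∈ L^∞_t H^k_x` for all `k`, `p ∈ L^∞_t H^k_x` (`k ≤ 0`
suffices) and `u ∈ C([0, T]; L²)` — the class delivered by `NS.tao2011_smooth_local_existence`
(Tao 2013, Thm. 5.4 (i), (iv)) — is a Leray–Hopf weak solution on `[0, T)` from `u(0)`: the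
integrability clauses of the proved `Fluid.IsClassicalNSSolutionOn.isLerayHopfOn_holds`
(`∇u ∈ L²_{t,x}`, `u ∈ L³_{t,x}`, `p u ∈ L¹_{t,x}`) follow from the `L^∞_t L²_x` bounds on
`u`, `Du`, `p` and the boundedness of `u` (Sobolev imbedding). [cite: Tao2011, Thm. 5.4 (i)+(iv)] -/
theorem isLerayHopfOn_of_hasBoundedSobolevNormsOn {ν T : ℝ} (hT : 0 < T)
    {u : ℝ → EuclideanSpace ℝ (Fin 3) → EuclideanSpace ℝ (Fin 3)}
    {p : ℝ → EuclideanSpace ℝ (Fin 3) → ℝ} (hsol : FluidPDE.IsClassicalNSSolutionOn (Icc 0 T) ν 0 u p)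
    (hu : HasBoundedSobolevNormsOn (Icc 0 T) u)
    (hp : ∀ n : ℕ, ∃ C : ℝ≥0, ∀ t ∈ Icc 0 T, ∫⁻ x, ‖iteratedFDeriv ℝ n (p t) x‖ₑ ^ 2 ≤ C)
    (hc : FluidPDE.ContinuousInLpOn (Icc 0 T) 2 u) :
    FluidPDE.IsLerayHopfOn T ν 0 (u 0) u := by
  obtain ⟨B, hB0, hB⟩ := exists_forall_norm_le_of_hasBoundedSobolevNormsOn hsol hu
  obtain ⟨C₀, hC₀⟩ := hu 0
  obtain ⟨C₁, hC₁⟩ := hu 1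
  obtain ⟨P₀, hP₀⟩ := hp 0
  have hvol : volume (Ioo (0 : ℝ) T) < ⊤ := by simp
  -- `∫ |u(t)|² ≤ C₀`, `∫ |p(t)|² ≤ P₀`
  have hu0 : ∀ t ∈ Icc 0 T, ∫⁻ x, ‖u t x‖ₑ ^ 2 ≤ C₀ := fun t ht =>
    (le_of_eq (lintegral_congr fun x => by rw [← ofReal_norm, ← norm_iteratedFDeriv_zero (𝕜 := ℝ)
      (f := u t), ofReal_norm])).trans (hC₀ t ht)
  have hp0 : ∀ t ∈ Icc 0 T, ∫⁻ x, ‖p t x‖ₑ ^ 2 ≤ P₀ := fun t ht =>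
    (le_of_eq (lintegral_congr fun x => by rw [← ofReal_norm, ← norm_iteratedFDeriv_zero (𝕜 := ℝ)
      (f := p t), ofReal_norm])).trans (hP₀ t ht)
  refine IsClassicalNSSolutionOn.isLerayHopfOn_holds hsol hT Subset.rfl hc ?_ ?_ ?_ ?_
  · -- `∇u ∈ L²_{t,x}`
    have hle : ∀ t ∈ Icc 0 T,
        ∫⁻ x, ENNReal.ofReal (FluidPDE.frobeniusNormSq (fderiv ℝ (u t) x)) ≤ 3 * C₁ := by
      intro t ht
      calc ∫⁻ x, ENNReal.ofReal (FluidPDE.frobeniusNormSq (fderiv ℝ (u t) x))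
          ≤ ∫⁻ x, 3 * ‖iteratedFDeriv ℝ 1 (u t) x‖ₑ ^ 2 := lintegral_mono fun x => by
            rw [← ofReal_norm, norm_iteratedFDeriv_one, ofReal_norm]
            exact ofReal_frobeniusNormSq_le_three_mul_enorm_sq _
        _ = 3 * ∫⁻ x, ‖iteratedFDeriv ℝ 1 (u t) x‖ₑ ^ 2 := lintegral_const_mul' _ _ (by simp)
        _ ≤ 3 * C₁ := by gcongr; exact hC₁ t ht
    calc ∫⁻ t in Ioo 0 T, ∫⁻ x, ENNReal.ofReal (FluidPDE.frobeniusNormSq (fderiv ℝ (u t) x))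
        ≤ ∫⁻ _ in Ioo 0 T, 3 * (C₁ : ℝ≥0∞) :=
          setLIntegral_mono' measurableSet_Ioo fun t ht => hle t (Ioo_subset_Icc_self ht)
      _ < ⊤ := by
          rw [setLIntegral_const]
          exact ENNReal.mul_lt_top (ENNReal.mul_lt_top (by simp) ENNReal.coe_lt_top) hvol
  · -- `u ∈ L³_{t,x}`
    have hle : ∀ t ∈ Icc 0 T, ∫⁻ x, ‖u t x‖ₑ ^ (3 : ℕ) ≤ ENNReal.ofReal B * C₀ := by
      intro t ht
      calc ∫⁻ x, ‖u t x‖ₑ ^ (3 : ℕ) ≤ ∫⁻ x, ENNReal.ofReal B * ‖u t x‖ₑ ^ 2 :=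
            lintegral_mono fun x => by
              rw [pow_succ, mul_comm]
              gcongr
              rw [← ofReal_norm]
              exact ENNReal.ofReal_le_ofReal (hB t ht x)
        _ = ENNReal.ofReal B * ∫⁻ x, ‖u t x‖ₑ ^ 2 := lintegral_const_mul' _ _ ENNReal.ofReal_ne_top
        _ ≤ ENNReal.ofReal B * C₀ := by gcongr; exact hu0 t ht
    calc ∫⁻ t in Ioo 0 T, ∫⁻ x, ‖u t x‖ₑ ^ (3 : ℕ)
        ≤ ∫⁻ _ in Ioo 0 T, ENNReal.ofReal B * (C₀ : ℝ≥0∞) :=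
          setLIntegral_mono' measurableSet_Ioo fun t ht => hle t (Ioo_subset_Icc_self ht)
      _ < ⊤ := by
          rw [setLIntegral_const]
          exact ENNReal.mul_lt_top (ENNReal.mul_lt_top ENNReal.ofReal_lt_top ENNReal.coe_lt_top) hvol
  · -- `p u ∈ L¹_{t,x}`
    have hle : ∀ t ∈ Icc 0 T, ∫⁻ x, ‖p t x‖ₑ * ‖u t x‖ₑ ≤ P₀ + C₀ := by
      intro t ht
      calc ∫⁻ x, ‖p t x‖ₑ * ‖u t x‖ₑ ≤ ∫⁻ x, (‖p t x‖ₑ ^ 2 + ‖u t x‖ₑ ^ 2) :=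
            lintegral_mono fun x => FluidPDE.ennreal_mul_le_sq_add_sq _ _
        _ = (∫⁻ x, ‖p t x‖ₑ ^ 2) + ∫⁻ x, ‖u t x‖ₑ ^ 2 :=
            lintegral_add_left' ((hsol.contDiff_pressure ht).continuous.aemeasurable.enorm.pow_const
              _) _
        _ ≤ P₀ + C₀ := add_le_add (hp0 t ht) (hu0 t ht)
    calc ∫⁻ t in Ioo 0 T, ∫⁻ x, ‖p t x‖ₑ * ‖u t x‖ₑ
        ≤ ∫⁻ _ in Ioo 0 T, ((P₀ : ℝ≥0∞) + C₀) :=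
          setLIntegral_mono' measurableSet_Ioo fun t ht => hle t (Ioo_subset_Icc_self ht)
      _ < ⊤ := by
          rw [setLIntegral_const]
          exact ENNReal.mul_lt_top (by simp [ENNReal.add_lt_top]) hvol
  · -- no force
    simp

/-! ### Restart and comparison -/

/-- **Restarting at a good time and comparing** (with the *proved* weak–strong uniqueness
theorem `serrin_weak_strong_uniqueness_holds` of `NSSerrinUniqueness.lean`, datum in `L²`). Let
`(u, p)` be classical on `[0, T)`, let `u(· + t')` be Leray–Hopf on `[0, T - t')` from `u(t')`
(`t' < T` an energy-good time; in particular `u(t') ∈ L²`), and let `(v, q)` be a classical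
solution on `[0, τ]` from the same datum `v(0) = u(t')` in Tao's class (Sobolev bounds,
`L²`-continuity). Then `u(t + t') = v(t)` for all `0 ≤ t < min(τ, T - t')`: `v` is bounded and
Leray–Hopf, so weak–strong uniqueness in the Serrin class `q = r = ∞` gives a.e. equality of
the slices, and both slices are continuous (Prodi 1959; Serrin 1963, Thm. 6;
Robinson–Rodrigo–Sadowski 2016, Thm. 8.19). [cite: Prodi1959] -/
theorem eq_restart_of_serrin (hWS : serrin_weak_strong_uniqueness) {ν T τ t' : ℝ} (hν : 0 < ν)
    (hτ : 0 < τ) (ht'0 : 0 ≤ t') (ht'T : t' < T)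
    {u : ℝ → EuclideanSpace ℝ (Fin 3) → EuclideanSpace ℝ (Fin 3)}
    {p : ℝ → EuclideanSpace ℝ (Fin 3) → ℝ} (hsol : FluidPDE.IsClassicalNSSolutionOn (Ico 0 T) ν 0 u p)
    (hLHt : FluidPDE.IsLerayHopfOn (T - t') ν 0 (u t') (fun t => u (t + t')))
    {v : ℝ → EuclideanSpace ℝ (Fin 3) → EuclideanSpace ℝ (Fin 3)}
    {q : ℝ → EuclideanSpace ℝ (Fin 3) → ℝ} (hv : FluidPDE.IsClassicalNSSolutionOn (Icc 0 τ) ν 0 v q)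
    (hv0 : v 0 = u t') (hvb : HasBoundedSobolevNormsOn (Icc 0 τ) v)
    (hqb : ∀ n : ℕ, ∃ C : ℝ≥0, ∀ t ∈ Icc 0 τ, ∫⁻ x, ‖iteratedFDeriv ℝ n (q t) x‖ₑ ^ 2 ≤ C)
    (hvc : FluidPDE.ContinuousInLpOn (Icc 0 τ) 2 v) :
    ∀ t ∈ Ico 0 (min τ (T - t')), u (t + t') = v t := by
  set T' := min τ (T - t') with hT'
  have hT'pos : 0 < T' := lt_min hτ (by linarith)
  -- `v` is Leray–Hopf on `[0, T')` from `u t'`, and bounded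
  have hLHv : FluidPDE.IsLerayHopfOn T' ν 0 (u t') v := by
    rw [← hv0]
    exact (isLerayHopfOn_of_hasBoundedSobolevNormsOn hτ hv hvb hqb hvc).of_le (min_le_left _ _)
  obtain ⟨B, hB0, hB⟩ := exists_forall_norm_le_of_hasBoundedSobolevNormsOn hv hvb
  have hS : FluidPDE.MemLqLp ∞ ∞ v (Ioo 0 T') :=
    memLqLp_top_top_of_forall_norm_le measurableSet_Ioo hB0
      (fun t ht => (hv.contDiff_velocity ⟨ht.1.le, ht.2.le.trans (min_le_left _ _)⟩).continuous)
      fun t ht x => hB t ⟨ht.1.le, ht.2.le.trans (min_le_left _ _)⟩ x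
  have hLHu : FluidPDE.IsLerayHopfOn T' ν 0 (u t') (fun t => u (t + t')) :=
    hLHt.of_le (min_le_right _ _)
  have hmem : MemLp (u t') 2 volume := by
    simpa using hLHt.memLp 0 ⟨le_rfl, by linarith⟩
  have hae := hWS hν hT'pos hLHv hmem (q := ⊤) (r := ⊤) (by simp) (by simp) hS hLHu
  intro t ht
  rcases eq_or_lt_of_le ht.1 with h0 | h0
  · rw [← h0, zero_add, hv0]
  · have htT : t + t' ∈ Ico 0 T := ⟨by linarith, by
      have := ht.2.trans_le (min_le_right _ _); linarith⟩
    exact eq_of_ae_eq_of_continuous (hsol.contDiff_velocity htT).continuous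
      (hv.contDiff_velocity ⟨ht.1, ht.2.le.trans (min_le_left _ _)⟩).continuous
      (hae t ⟨h0, ht.2.le⟩)

/-- **Restarting at a good time and comparing.** Let `(u, p)` be classical on `[0, T)`, let
`u(· + t')` be Leray–Hopf on `[0, T - t')` from `u(t')` (`t' < T` an energy-good time), and let
`(v, q)` be a classical solution on `[0, τ]` from the same datum `v(0) = u(t')` in Tao's class
(Sobolev bounds, `L²`-continuity). Then `u(t + t') = v(t)` for all `0 ≤ t < min(τ, T - t')`:
`v` is bounded and Leray–Hopf, so weak–strong uniqueness (`NS.weak_strong_uniqueness` with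
`q = r = ∞`) gives a.e. equality of the slices, and both slices are continuous
(Prodi 1959; Serrin 1963; Robinson–Rodrigo–Sadowski 2016, Thm. 8.19). [cite: Prodi1959] -/
theorem eq_restart_of_weak_strong (hWS : weak_strong_uniqueness) {ν T τ t' : ℝ} (hν : 0 < ν)
    (hτ : 0 < τ) (ht'0 : 0 ≤ t') (ht'T : t' < T)
    {u : ℝ → EuclideanSpace ℝ (Fin 3) → EuclideanSpace ℝ (Fin 3)}
    {p : ℝ → EuclideanSpace ℝ (Fin 3) → ℝ} (hsol : FluidPDE.IsClassicalNSSolutionOn (Ico 0 T) ν 0 u p)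
    (hLHt : FluidPDE.IsLerayHopfOn (T - t') ν 0 (u t') (fun t => u (t + t')))
    {v : ℝ → EuclideanSpace ℝ (Fin 3) → EuclideanSpace ℝ (Fin 3)}
    {q : ℝ → EuclideanSpace ℝ (Fin 3) → ℝ} (hv : FluidPDE.IsClassicalNSSolutionOn (Icc 0 τ) ν 0 v q)
    (hv0 : v 0 = u t') (hvb : HasBoundedSobolevNormsOn (Icc 0 τ) v)
    (hqb : ∀ n : ℕ, ∃ C : ℝ≥0, ∀ t ∈ Icc 0 τ, ∫⁻ x, ‖iteratedFDeriv ℝ n (q t) x‖ₑ ^ 2 ≤ C)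
    (hvc : FluidPDE.ContinuousInLpOn (Icc 0 τ) 2 v) :
    ∀ t ∈ Ico 0 (min τ (T - t')), u (t + t') = v t :=
  eq_restart_of_serrin (serrin_weak_strong_uniqueness_of_weak_strong_uniqueness hWS) hν hτ ht'0
    ht'T hsol hLHt hv hv0 hvb hqb hvc

/-! ### Assembly 3 -/

/-- **The `L³` continuation criterion from ESS (3.6), Tao's smooth `H¹` local theory and
weak–strong uniqueness (datum in `L²`).** Given the named facts `NS.ess_sup_bound`
(Escauriaza–Seregin–Šverák 2003, §3 (3.5)–(3.6)), `NS.tao2011_smooth_local_existence` (Tao 2013,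
Thm. 5.4 (ii)+(iv)) and `NS.serrin_weak_strong_uniqueness` (Prodi–Serrin with datum in `L²`;
*proved* in `NSSerrinUniqueness.lean`), every classical unforced solution on `ℝ³ × [0, T)`
which is Leray–Hopf from its rapidly decaying datum and has `sup_{0 ≤ t < T} ‖u(t)‖_{L³} < ∞`
extends as a classical solution past `T`. The proof is the marching argument of the module
docstring: ESS bounds `u` on `(δ, T) × ℝ³`; the enstrophy inequality under this `L^∞` bound
(`lintegral_frobeniusNormSq_fderiv_le_mul_exp`, Lemarié-Rieusset 2016 Thm. 11.2) keeps
`‖u(t)‖_{H¹}` uniformly bounded at the restarting times, so Tao's local solutions have a uniform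
lifespan `τ`; restarting at energy-good times (`IsLerayHopfOn.ae_isLerayHopfOn_translate`),
identifying by weak–strong uniqueness (`eq_restart_of_serrin`; the restart data `u(t')` are in `L²`) and advancing by `τ/4` each
time, one reaches past `T` (`HasSmoothExtensionPast.of_translate`) — contradicting maximality.
This is the blow-up alternative of Tao 2013, Cor. "Maximal Cauchy development" (arXiv Cor. 35)
combined with Serrin's criterion at the endpoint `(2, ∞)`. [cite: EscauriazaSereginSverak2003, Thm. 1.3 with §3 (3.5)–(3.6)] -/
theorem hasSmoothExtensionPast_of_eLpNorm_three_bounded_of_tao' (h36 : ess_sup_bound)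
    (hE : tao2011_smooth_local_existence) (hWS : serrin_weak_strong_uniqueness) :
    hasSmoothExtensionPast_of_eLpNorm_three_bounded := by
  intro ν T hν hT u p hsol hLH h₀ h₃
  by_contra hnot
  obtain ⟨c, hc, hloc⟩ := hE
  -- `u ∈ L^∞(0, T; L³)` with datum in `J̊`
  have hL3 : FluidPDE.MemLqLp ∞ 3 u (Ioo 0 T) := memLqLp_top_three_of_iSup_lt_top
    (fun t ht => (hsol.contDiff_velocity ht).continuous.aestronglyMeasurable) h₃
  have hdat2 : MemLp (u 0) 2 volume := hLH.memLp 0 ⟨le_rfl, hT.le⟩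
  have hdiv0 : FluidPDE.IsWeaklyDivFree (u 0) := hLH.isWeaklyDivFree_datum hT
  have h0I : (0 : ℝ) ∈ Ico 0 T := ⟨le_rfl, hT⟩
  -- energy bound `∫ |u(t)|² ≤ 2 E₀`
  set e₀ : ℝ := 2 * VectorCalculus.kineticEnergy (u 0) with he₀
  have he₀0 : 0 ≤ e₀ := mul_nonneg zero_le_two (FluidPDE.kineticEnergy_nonneg _)
  have hener : ∀ t ∈ Icc 0 T, ∫⁻ x, ‖u t x‖ₑ ^ 2 ≤ ENNReal.ofReal e₀ := fun t ht =>
    hLH.lintegral_enorm_sq_le hν.le ht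
  /- ### Step 1: a first smooth patch from the Schwartz datum -/
  have hHinf0 : ∀ n : ℕ, ∫⁻ x, ‖iteratedFDeriv ℝ n (u 0) x‖ₑ ^ 2 < ⊤ :=
    h₀.lintegral_enorm_iteratedFDeriv_sq_lt_top
  have hfrob_le3 : ∀ w : EuclideanSpace ℝ (Fin 3) → EuclideanSpace ℝ (Fin 3),
      ∫⁻ x, ENNReal.ofReal (FluidPDE.frobeniusNormSq (fderiv ℝ w x)) ≤
        3 * ∫⁻ x, ‖iteratedFDeriv ℝ 1 w x‖ₑ ^ 2 := by
    intro w
    calc ∫⁻ x, ENNReal.ofReal (FluidPDE.frobeniusNormSq (fderiv ℝ w x))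
        ≤ ∫⁻ x, 3 * ‖iteratedFDeriv ℝ 1 w x‖ₑ ^ 2 := lintegral_mono fun x => by
          rw [← ofReal_norm, norm_iteratedFDeriv_one, ofReal_norm]
          exact ofReal_frobeniusNormSq_le_three_mul_enorm_sq _
      _ = 3 * ∫⁻ x, ‖iteratedFDeriv ℝ 1 w x‖ₑ ^ 2 := lintegral_const_mul' _ _ (by simp)
  have hfrob0 : ∫⁻ x, ENNReal.ofReal (FluidPDE.frobeniusNormSq (fderiv ℝ (u 0) x)) < ⊤ :=
    (hfrob_le3 (u 0)).trans_lt (ENNReal.mul_lt_top (by simp) (hHinf0 1))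
  set A₀ : ℝ := ((∫⁻ x, ‖u 0 x‖ₑ ^ 2) +
    ∫⁻ x, ENNReal.ofReal (FluidPDE.frobeniusNormSq (fderiv ℝ (u 0) x))).toReal with hA₀
  have hA₀0 : 0 ≤ A₀ := ENNReal.toReal_nonneg
  have hA₀eq : (∫⁻ x, ‖u 0 x‖ₑ ^ 2) + ∫⁻ x, ENNReal.ofReal (FluidPDE.frobeniusNormSq (fderiv ℝ (u 0) x))
      ≤ ENNReal.ofReal A₀ := by
    rw [hA₀, ENNReal.ofReal_toReal]
    exact ENNReal.add_ne_top.2 ⟨((hener 0 ⟨le_rfl, hT.le⟩).trans_lt ENNReal.ofReal_lt_top).ne,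
      hfrob0.ne⟩
  set T₁ : ℝ := min (T / 2) (c * ν ^ 3 / (A₀ ^ 2 + 1)) with hT₁
  have hT₁pos : 0 < T₁ := lt_min (by linarith) (by positivity)
  have hT₁T : T₁ < T := (min_le_left _ _).trans_lt (by linarith)
  have hT₁c : A₀ ^ 2 * T₁ ≤ c * ν ^ 3 := by
    calc A₀ ^ 2 * T₁ ≤ A₀ ^ 2 * (c * ν ^ 3 / (A₀ ^ 2 + 1)) :=
          mul_le_mul_of_nonneg_left (min_le_right _ _) (sq_nonneg _)
      _ = c * ν ^ 3 * (A₀ ^ 2 / (A₀ ^ 2 + 1)) := by ring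
      _ ≤ c * ν ^ 3 * 1 :=
          mul_le_mul_of_nonneg_left (by rw [div_le_one (by positivity)]; linarith) (by positivity)
      _ = c * ν ^ 3 := mul_one _
  obtain ⟨v₀, q₀, hv₀, hv₀0, hv₀b, -, hq₀b, hv₀c⟩ := hloc hν hT₁pos (hsol.contDiff_velocity h0I)
    (hsol.divFree 0 h0I) hHinf0 hA₀0 hA₀eq hT₁c
  -- `u = v₀` on `[0, T₁]` (restart at the good time `0`)
  have hLH0 : FluidPDE.IsLerayHopfOn (T - 0) ν 0 (u 0) (fun t => u (t + 0)) := by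
    simpa using hLH
  have heq0 : ∀ t ∈ Ico 0 (min T₁ (T - 0)), u (t + 0) = v₀ t :=
    eq_restart_of_serrin hWS hν hT₁pos le_rfl hT hsol hLH0 hv₀ hv₀0 hv₀b hq₀b hv₀c
  have heq0' : ∀ t ∈ Ico 0 T₁, u t = v₀ t := fun t ht => by
    have := heq0 t ⟨ht.1, lt_min ht.2 (by linarith [ht.2])⟩
    simpa using this
  /- ### Step 2: the ESS bound on `(T₁/4, T)` -/
  have hδ : T₁ / 4 ∈ Ioo 0 T := ⟨by positivity, by linarith⟩
  have hbd : FluidPDE.MemLqLp ∞ ∞ u (Ioo (T₁ / 4) T) := h36 hν hT hdat2 hdiv0 hLH hL3 _ hδ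
  have hcontu : ContinuousOn (uncurry u) (Ioo (T₁ / 4) T ×ˢ univ) :=
    hsol.smooth_velocity.continuousOn.mono (prod_mono (fun t ht => ⟨hδ.1.le.trans ht.1.le, ht.2⟩)
      Subset.rfl)
  obtain ⟨M₀, hM₀⟩ := exists_forall_norm_le_of_memLqLp_top_top hcontu hbd
  set M : ℝ := max M₀ 1 with hM
  have hMpos : 0 < M := lt_of_lt_of_le one_pos (le_max_right _ _)
  have hMb : ∀ t ∈ Ioo (T₁ / 4) T, ∀ x, ‖u t x‖ ≤ M := fun t ht x =>
    (hM₀ t ht x).trans (le_max_left _ _)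
  /- ### Step 3: a good restarting time `t⋆ ∈ (T₁/2, T₁)` and the constants -/
  obtain ⟨tstar, htstar, hLHstar⟩ : ∃ s ∈ Ioo (T₁ / 2) T₁,
      FluidPDE.IsLerayHopfOn (T - s) ν 0 (u s) (fun t => u (t + s)) := by
    have hae := hLH.ae_isLerayHopfOn_translate hsol hν.le
    have hsub : Ioo (T₁ / 2) T₁ ⊆ Ioo 0 T := fun s hs => ⟨by linarith [hs.1], hs.2.trans hT₁T⟩
    have hae' : ∀ᵐ s ∂(volume.restrict (Ioo (T₁ / 2) T₁)),
        FluidPDE.IsLerayHopfOn (T - s) ν 0 (u s) (fun t => u (t + s)) :=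
      ae_restrict_of_ae_restrict_of_subset hsub hae
    exact exists_mem_Ioo_of_ae_restrict (by linarith) hae'
  have htstarT : tstar < T := htstar.2.trans hT₁T
  have htstar0 : 0 < tstar := by linarith [htstar.1]
  -- the slice `u t⋆` lies in the first patch
  have hslice_star : u tstar = v₀ tstar := heq0' tstar ⟨htstar0.le, htstar.2⟩
  have hstarI : tstar ∈ Icc 0 T₁ := ⟨htstar0.le, htstar.2.le⟩
  have hg₀fin : ∫⁻ x, ENNReal.ofReal (FluidPDE.frobeniusNormSq (fderiv ℝ (u tstar) x)) < ⊤ := by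
    obtain ⟨C₁, hC₁⟩ := hv₀b 1
    rw [hslice_star]
    exact (hfrob_le3 (v₀ tstar)).trans_lt
      (ENNReal.mul_lt_top (by simp) ((hC₁ tstar hstarI).trans_lt ENNReal.coe_lt_top))
  set g₀ : ℝ := (∫⁻ x, ENNReal.ofReal (FluidPDE.frobeniusNormSq (fderiv ℝ (u tstar) x))).toReal
    with hg₀
  have hg₀0 : 0 ≤ g₀ := ENNReal.toReal_nonneg
  set κ : ℝ := M ^ 2 / (2 * ν) with hκ
  have hκ0 : 0 ≤ κ := by positivity
  set A : ℝ := e₀ + g₀ * Real.exp (κ * T) with hA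
  have hApos : 0 ≤ A := by positivity
  set τ : ℝ := c * ν ^ 3 / ((A + 1) ^ 2) with hτ
  have hτpos : 0 < τ := by positivity
  have hτc : (A + 1) ^ 2 * τ ≤ c * ν ^ 3 := by
    rw [hτ, mul_div_cancel₀ _ (by positivity)]
  /- ### The invariant -/
  set Inv : ℝ → Prop := fun F => ∀ t ∈ Icc tstar F,
    (∫⁻ x, ENNReal.ofReal (FluidPDE.frobeniusNormSq (fderiv ℝ (u t) x)) ≤
        ENNReal.ofReal (g₀ * Real.exp (κ * (t - tstar)))) ∧
      ∀ n : ℕ, ∫⁻ x, ‖iteratedFDeriv ℝ n (u t) x‖ₑ ^ 2 < ⊤ with hInv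
  -- base: `Inv t⋆`
  have hbase : Inv tstar := by
    intro t ht
    have hteq : t = tstar := le_antisymm ht.2 ht.1
    subst hteq
    refine ⟨?_, fun n => ?_⟩
    · rw [sub_self, mul_zero, Real.exp_zero, mul_one, hg₀, ENNReal.ofReal_toReal hg₀fin.ne]
    · obtain ⟨C, hC⟩ := hv₀b n
      rw [hslice_star]
      exact (hC _ hstarI).trans_lt ENNReal.coe_lt_top
  /- ### Step 4: the marching step -/
  have hstep : ∀ F, tstar ≤ F → F < T → Inv F → Inv (F + τ / 4) ∧ F + τ / 4 < T := by
    intro F hF hFT hIF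
    -- a good restarting time `t' ∈ (F - τ/4, F] ∩ [t⋆, F]`
    obtain ⟨t', ht'1, ht'2, ht'3, hLHt'⟩ : ∃ t', tstar ≤ t' ∧ t' ≤ F ∧ F - τ / 4 < t' ∧
        FluidPDE.IsLerayHopfOn (T - t') ν 0 (u t') (fun t => u (t + t')) := by
      rcases eq_or_lt_of_le hF with h | h
      · exact ⟨tstar, le_rfl, h.le, by linarith, hLHstar⟩
      · set a := max tstar (F - τ / 4) with ha
        have haF : a < F := max_lt h (by linarith)
        have hae := hLH.ae_isLerayHopfOn_translate hsol hν.le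
        have hsub : Ioo a F ⊆ Ioo 0 T := fun s hs =>
          ⟨htstar0.trans_le ((le_max_left _ _).trans hs.1.le), hs.2.trans hFT⟩
        have hae' : ∀ᵐ s ∂(volume.restrict (Ioo a F)),
            FluidPDE.IsLerayHopfOn (T - s) ν 0 (u s) (fun t => u (t + s)) :=
          ae_restrict_of_ae_restrict_of_subset hsub hae
        obtain ⟨s, h2, h1⟩ := exists_mem_Ioo_of_ae_restrict haF hae'
        exact ⟨s, (le_max_left _ _).trans h2.1.le, h2.2.le,
          (le_max_right _ _).trans_lt h2.1, h1⟩
    have ht'T : t' < T := ht'2.trans_lt hFT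
    have ht'0 : 0 < t' := htstar0.trans_le ht'1
    have ht'I : t' ∈ Icc tstar F := ⟨ht'1, ht'2⟩
    obtain ⟨hIt'1, hIt'2⟩ := hIF t' ht'I
    -- the datum `u t'` and its `H¹` bound
    have hexp_le : Real.exp (κ * (t' - tstar)) ≤ Real.exp (κ * T) :=
      Real.exp_le_exp.2 (mul_le_mul_of_nonneg_left (by linarith) hκ0)
    have hAeq : (∫⁻ x, ‖u t' x‖ₑ ^ 2) +
        ∫⁻ x, ENNReal.ofReal (FluidPDE.frobeniusNormSq (fderiv ℝ (u t') x)) ≤ ENNReal.ofReal (A + 1) := by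
      calc (∫⁻ x, ‖u t' x‖ₑ ^ 2) + ∫⁻ x, ENNReal.ofReal (FluidPDE.frobeniusNormSq (fderiv ℝ (u t') x))
          ≤ ENNReal.ofReal e₀ + ENNReal.ofReal (g₀ * Real.exp (κ * (t' - tstar))) :=
            add_le_add (hener t' ⟨ht'0.le, ht'T.le⟩) hIt'1
        _ ≤ ENNReal.ofReal e₀ + ENNReal.ofReal (g₀ * Real.exp (κ * T)) := by
            gcongr
        _ = ENNReal.ofReal A := by rw [hA, ENNReal.ofReal_add he₀0 (by positivity)]
        _ ≤ ENNReal.ofReal (A + 1) := ENNReal.ofReal_le_ofReal (by linarith)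
    have ht'Ico : t' ∈ Ico 0 T := ⟨ht'0.le, ht'T⟩
    obtain ⟨v, q, hv, hv0, hvb, hvt, hqb, hvc⟩ := hloc hν hτpos (hsol.contDiff_velocity ht'Ico)
      (hsol.divFree t' ht'Ico) hIt'2 (by positivity) hAeq hτc
    -- identification on `[0, min τ (T - t'))`
    have heq := eq_restart_of_serrin hWS hν hτpos ht'0.le ht'T hsol hLHt' hv hv0 hvb hqb hvc
    -- the alternative `t' + τ > T` would extend `u` past `T`
    have hτle : t' + τ ≤ T := by
      by_contra hlt
      push Not at hlt
      apply hnot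
      refine HasSmoothExtensionPast.of_translate hsol ht'0 ht'T ⟨τ, by linarith, v, q,
        hv.mono Ico_subset_Icc_self (uniqueDiffOn_Ico 0 τ), fun t ht => ?_⟩
      exact (heq t ⟨ht.1, lt_min (by linarith [ht.2]) ht.2⟩).symm
    have hmin : min τ (T - t') = τ := min_eq_left (by linarith)
    rw [hmin] at heq
    -- `|v| ≤ M` on `[0, τ) × ℝ³`
    have hvM : ∀ s ∈ Ico 0 τ, ∀ x, ‖v s x‖ ≤ M := by
      intro s hs x
      rw [← heq s hs]
      exact hMb (s + t') ⟨by linarith [htstar.1, hs.1], by linarith [hs.2]⟩ x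
    refine ⟨?_, by linarith⟩
    -- the invariant on `[t⋆, F + τ/4]`
    intro t ht
    rcases le_or_gt t t' with hle | hgt
    · exact hIF t ⟨ht.1, hle.trans ht'2⟩
    · -- `t = t' + s` with `0 < s ≤ τ/2 < τ`
      have hs : t - t' ∈ Ioc 0 τ := ⟨by linarith, by linarith [ht.2]⟩
      have hslt : t - t' < τ := by linarith [ht.2]
      have hut : u t = v (t - t') := by
        have := heq (t - t') ⟨hs.1.le, hslt⟩
        rwa [sub_add_cancel] at this
      refine ⟨?_, fun n => ?_⟩
      · -- enstrophy: Grönwall for `v` on `[0, t - t']`, anchored at `v 0 = u t'`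
        have hG := lintegral_frobeniusNormSq_fderiv_le_mul_exp hν hτpos hv hvb hvt hqb hMpos hs
          (fun s hs' x => hvM s ⟨hs'.1, hs'.2.trans_lt hslt⟩ x)
        rw [hut]
        refine hG.trans ?_
        rw [hv0]
        calc ENNReal.ofReal (Real.exp (M ^ 2 * (t - t') / (2 * ν))) *
              ∫⁻ x, ENNReal.ofReal (FluidPDE.frobeniusNormSq (fderiv ℝ (u t') x))
            ≤ ENNReal.ofReal (Real.exp (M ^ 2 * (t - t') / (2 * ν))) *
              ENNReal.ofReal (g₀ * Real.exp (κ * (t' - tstar))) := by gcongr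
          _ = ENNReal.ofReal (g₀ * Real.exp (κ * (t - tstar))) := by
              rw [← ENNReal.ofReal_mul (Real.exp_nonneg _)]
              congr 1
              rw [mul_left_comm, ← Real.exp_add, hκ]
              congr 1
              ring_nf
      · obtain ⟨C, hC⟩ := hvb n
        rw [hut]
        exact (hC _ ⟨hs.1.le, hs.2⟩).trans_lt ENNReal.coe_lt_top
  /- ### Step 5: iterate -/
  have hiter : ∀ k : ℕ, Inv (tstar + k * (τ / 4)) ∧ tstar + k * (τ / 4) < T := by
    intro k
    induction k with
    | zero => simpa using ⟨hbase, htstarT⟩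
    | succ k ih =>
      have h := hstep _ (by nlinarith [hτpos.le, (k.cast_nonneg : (0 : ℝ) ≤ k)]) ih.2 ih.1
      have : tstar + (k : ℝ) * (τ / 4) + τ / 4 = tstar + ((k + 1 : ℕ) : ℝ) * (τ / 4) := by
        push_cast; ring
      rw [this] at h
      exact h
  obtain ⟨k, hk⟩ := exists_nat_gt ((T - tstar) / (τ / 4))
  have h1 := (hiter k).2
  have h2 : T - tstar < k * (τ / 4) := by
    rwa [div_lt_iff₀ (by positivity)] at hk
  linarith

/-- **The `L³` continuation criterion from ESS (3.6), Tao's smooth `H¹` local theory and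
weak–strong uniqueness.** Given the named facts `NS.ess_sup_bound` (Escauriaza–Seregin–Šverák
2003, §3 (3.5)–(3.6)), `NS.tao2011_smooth_local_existence` (Tao 2013, Thm. 5.4 (ii)+(iv)) and
`NS.weak_strong_uniqueness` (Prodi–Serrin), every classical unforced solution on `ℝ³ × [0, T)`
which is Leray–Hopf from its rapidly decaying datum and has `sup_{0 ≤ t < T} ‖u(t)‖_{L³} < ∞`
extends as a classical solution past `T`. The proof is the marching argument of the module
docstring: ESS bounds `u` on `(δ, T) × ℝ³`; the enstrophy inequality under this `L^∞` bound
(`lintegral_frobeniusNormSq_fderiv_le_mul_exp`, Lemarié-Rieusset 2016 Thm. 11.2) keeps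
`‖u(t)‖_{H¹}` uniformly bounded at the restarting times, so Tao's local solutions have a uniform
lifespan `τ`; restarting at energy-good times (`IsLerayHopfOn.ae_isLerayHopfOn_translate`),
identifying by weak–strong uniqueness (`eq_restart_of_weak_strong`) and advancing by `τ/4` each
time, one reaches past `T` (`HasSmoothExtensionPast.of_translate`) — contradicting maximality.
This is the blow-up alternative of Tao 2013, Cor. "Maximal Cauchy development" (arXiv Cor. 35)
combined with Serrin's criterion at the endpoint `(2, ∞)`. [cite: EscauriazaSereginSverak2003, Thm. 1.3 with §3 (3.5)–(3.6)] -/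
theorem hasSmoothExtensionPast_of_eLpNorm_three_bounded_of_tao (h36 : ess_sup_bound)
    (hE : tao2011_smooth_local_existence) (hWS : weak_strong_uniqueness) :
    hasSmoothExtensionPast_of_eLpNorm_three_bounded :=
  hasSmoothExtensionPast_of_eLpNorm_three_bounded_of_tao' h36 hE
    (serrin_weak_strong_uniqueness_of_weak_strong_uniqueness hWS)

/-- **The `L³` continuation criterion from two named facts** — `NS.ess_sup_bound` (ESS 2003,
§3 (3.5)–(3.6)) and `NS.tao2011_smooth_local_existence` (Tao 2013, Thm. 5.4 (ii)+(iv)) — the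
weak–strong uniqueness input being the proved theorem `serrin_weak_strong_uniqueness_holds`
(Prodi 1959; Serrin 1963; Robinson–Rodrigo–Sadowski 2016, Thm. 8.19). This is the preferred
decomposition of `NS.hasSmoothExtensionPast_of_eLpNorm_three_bounded`. [cite: EscauriazaSereginSverak2003, Thm. 1.3 with §3 (3.5)–(3.6)] -/
theorem hasSmoothExtensionPast_of_eLpNorm_three_bounded_of_ess_tao (h36 : ess_sup_bound)
    (hE : tao2011_smooth_local_existence) : hasSmoothExtensionPast_of_eLpNorm_three_bounded :=
  hasSmoothExtensionPast_of_eLpNorm_three_bounded_of_tao' h36 hE serrin_weak_strong_uniqueness_holds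

/-- The preferred decomposition from the conjunction of its two open inputs, for the dependency
tracker. [cite: EscauriazaSereginSverak2003, Thm. 1.3 with §3 (3.5)–(3.6)] -/
theorem hasSmoothExtensionPast_of_eLpNorm_three_bounded_of_and₂
    (h : ess_sup_bound ∧ tao2011_smooth_local_existence) :
    hasSmoothExtensionPast_of_eLpNorm_three_bounded :=
  hasSmoothExtensionPast_of_eLpNorm_three_bounded_of_ess_tao h.1 h.2

/-- **The preferred decomposition of the `L³` continuation criterion, third form.** From the
conjunction of ESS (3.6), Tao's smooth `H¹` local existence theorem and weak–strong uniqueness —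
recorded for the dependency tracker. [cite: EscauriazaSereginSverak2003, Thm. 1.3 with §3 (3.5)–(3.6)] -/
theorem hasSmoothExtensionPast_of_eLpNorm_three_bounded_of_and₃
    (h : ess_sup_bound ∧ tao2011_smooth_local_existence ∧ weak_strong_uniqueness) :
    hasSmoothExtensionPast_of_eLpNorm_three_bounded :=
  hasSmoothExtensionPast_of_eLpNorm_three_bounded_of_tao h.1 h.2.1 h.2.2

end Literature.Analysis.FluidPDE

end
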